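import HarnessLib
import Summits.Ventures.WeilGRH.UniformConductorFloorPrincipal
import Summits.Ventures.WeilGRH.UniformConductorFloorCoprimeFloors57
import Summits.Ventures.WeilGRH.RealCharacterSmallModuli
import Summits.Ventures.WeilGRH.KCellsMod14OneA

/-!
# GRH arm (rh-explicit, venture WeilGRH): Weil positivity on `[−1, 1]` for EVERY non-principal Dirichlet character mod 14 — the complete level 14

Cell `rh-explicit`, WEIL TRACK — GRH ARM (seat weil-grh-1 gen12).  `(ℤ/14)ˣ = ⟨3⟩` is cyclic of order 6; every character mod 14 is induced from level 7:
`χ(3) = ζ^i`, `ζ = exp(2πi/6)`, `i < 6`, `χ(−1) = χ(3)^3 = (−1)^i`.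
* `i = 0`: the principal character — FAILS (`14 ∈ F`, weil-grh-1's flat-window witness `UniformFloor.not_weilPositivityOnChar_one_principal`);
* `i = 2, 4`: the LIFT of the cubic even class 7.2 / 7.4 to level 14 — the kernel-checked checker-K χ-cell `KCellsMod14OneA` (block `B = 20`, Schur columns
  to `80`, margin `λ = 0.201`; generated by this seat with weil-grh-2's pipeline);
* `i` odd: odd characters — the divisibility / odd floor `UniformFloor.weilPositivityOnChar_one_of_odd_not_mem_remainder₂` (`14 ∉ R₁′`: `2 ∣ q ≥ 14`).
Hence at level 14 EXACTLY the principal character fails: `WeilPositivityOnChar χ 1 ↔ χ ≠ 1`.  Pure assembly; RH/GRH-free; standard axioms.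
-/

noncomputable section

namespace Summit.Ventures.WeilGRH.OneCompleteMod14
open Literature.NumberTheory.LFunctions
open scoped Real

/-- ★ **Every non-principal Dirichlet character mod 14 satisfies Weil positivity on `[−1, 1]`.**
[cite: Weil1952FormulesExplicites, (11) pp. 261–262 and the «lemme» p. 262] -/
theorem weilPositivityOnChar_mod14_one (χ : DirichletCharacter ℂ 14) (hχ : χ ≠ 1) : WeilPositivityOnChar χ 1 := by
  rcases χ.even_or_odd with he | ho
  · have zeta_pow_half : (Complex.exp (2 * ↑Real.pi * Complex.I / 6)) ^ 3 = -1 := by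
      rw [← Complex.exp_nat_mul, show ((3 : ℕ) : ℂ) * (2 * ↑Real.pi * Complex.I / 6) = ↑Real.pi * Complex.I by push_cast; ring]
      exact Complex.exp_pi_mul_I
    have hz : χ (3 : ZMod 14) ^ 6 = 1 := by
      rw [← map_pow, show (3 : ZMod 14) ^ 6 = 1 from by decide, map_one]
    have hprim : IsPrimitiveRoot (Complex.exp (2 * ↑Real.pi * Complex.I / 6)) 6 := by
      exact_mod_cast Complex.isPrimitiveRoot_exp 6 (by norm_num)
    obtain ⟨i, hi, hiz⟩ := hprim.eq_pow_of_pow_eq_one hz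
    have hm1 : χ (-1) = (Complex.exp (2 * ↑Real.pi * Complex.I / 6)) ^ (i * 3) := by
      rw [pow_mul, hiz, ← map_pow, show (3 : ZMod 14) ^ 3 = -1 from by decide]
    have he1 : χ (-1) = 1 := he
    interval_cases i
    · exact absurd (RealCharacterSmallModuli.eq_one_of_apply_gen RealCharacterSmallModuli.units_mod_fourteen_gen (by rw [← hiz, pow_zero])) hχ
    · exfalso; rw [hm1, show 1 * 3 = 3 from rfl, zeta_pow_half] at he1; norm_num at he1
    · exact KCellsMod14OneA.weilPositivityOnChar_mod14_chi9_one χ hiz.symm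
    · exfalso; rw [hm1, show 3 * 3 = 3 * 3 from rfl, pow_mul, zeta_pow_half] at he1; norm_num at he1
    · exact KCellsMod14OneA.weilPositivityOnChar_mod14_chi9_one_conj χ hiz.symm
    · exfalso; rw [hm1, show 5 * 3 = 3 * 5 from rfl, pow_mul, zeta_pow_half] at he1; norm_num at he1
  · exact UniformFloor.weilPositivityOnChar_one_of_odd_not_mem_remainder₂ (by decide) χ (charParity_of_odd ho)

/-- ★★ **At level 14 EXACTLY the principal character fails Weil positivity on `[−1, 1]`**: `WeilPositivityOnChar χ 1 ↔ χ ≠ 1` for every Dirichlet character `χ` mod 14.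
[cite: Weil1952FormulesExplicites, (11) pp. 261–262 and the «lemme» p. 262] -/
theorem weilPositivityOnChar_one_iff_ne_one_mod14 (χ : DirichletCharacter ℂ 14) : WeilPositivityOnChar χ 1 ↔ χ ≠ 1 :=
  ⟨fun h h1 ↦ UniformFloor.not_weilPositivityOnChar_one_principal (q := 14) (by decide) (h1 ▸ h), weilPositivityOnChar_mod14_one χ⟩

/-- Every non-principal character mod 14 is Weil-positive on every window `[−t, t]`, `t ≤ 1`. [folklore] -/
theorem weilPositivityOnChar_of_le_one_mod14 (χ : DirichletCharacter ℂ 14) (hχ : χ ≠ 1) {t : ℝ} (ht : t ≤ 1) :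
    WeilPositivityOnChar χ t := fun g hg hsupp ↦
  weilPositivityOnChar_mod14_one χ hχ g hg (hsupp.trans (Set.Icc_subset_Icc (by linarith) ht))

end Summit.Ventures.WeilGRH.OneCompleteMod14

end
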